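import Summits.CriticalPhenomena.PercolationContinuityZ3.Theorems.PercNearOneGluingNoHeavyQuantBubbleData
import Summits.CriticalPhenomena.PercolationContinuityZ3.Theorems.PercNearOneGluingNoHeavyQuantThreeRootGateCoupling
import HarnessLib

/-!
# QUANT lane R8, T-DEC: THE BUBBLE FAMILY WITH LEAF ATOMIZATION ('identity I_k⁺') — the count-level upgrade of arm-1 g47's bubble recursion:
# every box hung as a LEAF at a gate `λ` with `λ·R < r` is replaced, inside its piece, by its atoms re-gated to the common mean
# (`gate_λ ρ = Σ_m ρ(m)·(m/R)·gate_{λR/m} δ_m`); the carrier and every other box untouched; the sibling step on the enlarged region, every width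

builds on p205010 (kernel theorem, internal audit signed; external expert review pending)

Support + definition file (`--supports stmt-CriticalPhenomena-4575`), QUANT lane seat prim-quant-arm-1 (gen 47, architect), rung R8 of
`run/shared/lean/prim/quant/LADDER.md`; memo `run/shared/lean/prim/quant/prim-quant-arm-1-g47/ARCH-G47.md` §8 (exact numerics: the leaf split is a law
identity with ALL versions of the same mean, 472/472 random cases; coverage of I_k⁺ on generic k-2-chain forests 270/300 (k = 3; identity I: 180), 257–261
(k = 4; 170), 262–264 (k = 5; 194), composite boxes 266/300 (156), 270/300 (182); with the atomic theorem 286 · 279 · 284 /300).  Theorems only (no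
definitions), standard axioms, no sorries.  Continues `…QuantBubbleData` (the gates `blam`/`bkap`, the region `BubbleOK`, `bubble_scalars`,
`bubble_step_facts`; the leaf-atomization data `gate_eq_sum_regated_atoms`, `leaf_versions`, `xfl`, `bflS`, `bflS_pos`) and `…QuantCompoundCut` (`fbeta`,
`sdec_flaw_cons_of_upart`).

THE MOVE (memo §8).  In a bubble piece a box `b` added by an X-step is a LEAF hung at the gate `λ = blam` (no descendants, ever).  The one-box identity
`gate ρ λ = Σ_{m ≤ M} (ρ(m)·m/R)·gate δ_m (λR/m)` (`gate_eq_sum_regated_atoms`: the re-gating identity of typer g39 / arm-1 g46 applied to ONE gated box)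
rewrites the leaf as a mixture of BLOBS `δ_m` at the gates `λR/m ≤ λR/r < 1` (legal iff `λ·R < r`, `r` = least charged atom), all of mean `λ·R` — so the
piece's law and mean are unchanged while the leaf's floor requirement drops from `λ·x₁(b)` to `λ·R/M·y₀` (a blob has internal floor as close to `1` as one
likes; `y₀ < 1` is a parameter).  The Y-steps, the weights, the region and the carrier are exactly those of `…QuantBubbleData/…BubbleFamily`.

* **`fbeta_bubble_split`** — the opened compound is a finite mixture (weights `≥ 0`, sum 1) of TREE-BUILT laws with `≤ fgates L − 1` gates, tops `≤ ftop L`,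
  floors `≥ bflS y₀ L`, all of mean exactly `bT L`.
* **`sdec_upart_of_bubble_split`**, **`sdec_flaw_cons_of_bubble_split`**: oracle, `sk.q < fQ L`, `BubbleOK L`, `0 < y₀ < 1`, `x ≤ fQ L · bflS y₀ L` ⟹
  `SDEC x (ftop (sk :: L)) (flaw (sk :: L))` (identity I_k⁺, every width).

HONEST STATUS: an explicit sub-family; `SiblingStep`, `GateStepN`, `FarTreeRow` OPEN; RATE class log\* / honest sentence unchanged.  [this work].
Nothing here is cited as a published result.  The gluing rows served [cite: KozmaNitzan2024, Conjecture 3 (p. 15)]; product measure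
[cite: Grimmett1999, §1.3 p. 10].
-/

noncomputable section

open scoped BigOperators
open Classical

namespace Summit.CriticalPhenomena.PercolationContinuityZ3.Theorems
namespace Quant
namespace LawDec

open Finset

/-! ### The bubble decomposition with leaf atomization -/

/-- **THE BUBBLE DECOMPOSITION WITH LEAF ATOMIZATION.**  As `fbeta_bubble` (`…QuantBubbleFamily`), with every X-leaf replaced by its family of
versions (`leaf_versions`): for a list `L` of tree-built siblings at floor `x` with `BubbleOK L` and a blob floor parameter `0 < y₀ < 1`, the opened
compound `fbeta L` is a finite mixture `Σ ωᵢ Pᵢ` (`ωᵢ ≥ 0`, `Σ ωᵢ = 1`) of laws TREE-BUILT at floors `yᵢ ≥ bflS y₀ L` with `mᵢ + 1 ≤ fgates L` gates on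
`{0..tᵢ}`, `tᵢ ≤ ftop L`, each of mean exactly `bT L`. [this work] -/
theorem fbeta_bubble_split {x : ℝ} (hx0 : 0 < x) (hx1 : x < 1) (y0 : ℝ) (hy0 : 0 < y0) (hy1 : y0 < 1) :
    ∀ (L : List Sib), (∀ s ∈ L, s.TreeOK x) → BubbleOK L →
      ∃ (ι : Type) (_ : Fintype ι) (ω : ι → ℝ) (m t : ι → ℕ) (y : ι → ℝ) (P : ι → ℕ → ℝ),
        (∀ i, 0 ≤ ω i) ∧ (∑ i, ω i = 1) ∧ (∀ h, fbeta L h = ∑ i, ω i * P i h) ∧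
        (∀ i, TreeBuiltN (y i) (m i) (t i) (P i) ∧ t i ≤ ftop L ∧ bflS y0 L ≤ y i ∧ m i + 1 ≤ fgates L ∧
          ∑ h ∈ Finset.range (t i + 1), (h : ℝ) * P i h = bT L)
  | [], _, hB => absurd hB (by simp [BubbleOK])
  | [s], hL, _ => by
    obtain ⟨hq0, hq1, hxq, hT, _⟩ := hL s List.mem_cons_self
    obtain ⟨_, _, ρ0, ρM, ρ1, _⟩ := hT.lawFacts
    refine ⟨Unit, inferInstance, fun _ => 1, fun _ => s.n, fun _ => s.M, fun _ => s.x₁, fun _ => s.ρ, fun _ => zero_le_one, by simp, fun h => ?_,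
      fun _ => ⟨hT, by simp [ftop], by simp [bflS], by simp [fgates], ?_⟩⟩
    · simp only [Finset.univ_unique, Finset.sum_singleton, one_mul, fbeta, flaw, fQ, ftop]
      rw [lconv_delta_left 0 s.M _ (fun k hk => by rw [gate_apply, ρM k hk, if_neg (by omega)]; ring) h, gate_apply]
      field_simp
      ring
    · simp only [bT, fmean, fQ]
      unfold Sib.mean
      field_simp
      ring
  | b :: s :: L'', hL, hB => by
    set L' : List Sib := s :: L'' with hL'def
    have hne : L' ≠ [] := by simp [hL'def]
    have hbT : b.TreeOK x := hL b List.mem_cons_self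
    have hLT : ∀ t ∈ L', t.TreeOK x := fun t ht => hL t (List.mem_cons_of_mem b ht)
    have hLL : ∀ t ∈ L', t.LawOK := fun t ht => (hLT t ht).lawOK
    obtain ⟨hB', h1, h2⟩ := hB
    obtain ⟨ι, hι, ω, m, t, y, P, hω0, hω1, hmix, hP⟩ := fbeta_bubble_split hx0 hx1 y0 hy0 hy1 L' hLT hB'
    obtain ⟨hq0, hq1, hxq, hTb, hnp⟩ := hbT
    obtain ⟨hx₁0, hx₁1, ρ0, ρM, ρ1, ρta⟩ := hTb.lawFacts
    have hR : 0 < b.mean := (mul_pos_iff_of_pos_left (hL b List.mem_cons_self).1).1 (Sib.qmean_pos b (hL b List.mem_cons_self))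
    have hT0 : 0 < bT L' := bT_pos L' hLT hne
    obtain ⟨hp0, hp1, hD0, hl0, hl1, hk0, hk1, hTc⟩ :=
      bubble_step_facts b L' (hL b List.mem_cons_self).lawOK hR hLL hne hT0 h1 h2
    have hD0' : (1 - bp b L') * b.mean + bp b L' * (1 - fQ L') * bT L' ≠ 0 := by
      have := hD0; unfold bD at this; exact this.ne'
    obtain ⟨huv, hmid, hu1, hv1⟩ := bubble_scalars (bp b L') (fQ L') b.mean (bT L') hR.ne' hT0.ne' hD0'
    obtain ⟨f0, fM, f1, _⟩ := flaw_facts L' hLL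
    obtain ⟨β0, βM, β1, βmean⟩ := fbeta_laws L' hLL hne
    obtain ⟨_, hQ1', hmem⟩ := fQ_facts L' hLL
    have hQ0' : 0 < fQ L' := lt_of_lt_of_le (hLT s List.mem_cons_self).1 (hmem s List.mem_cons_self)
    have hQc : fQ (b :: L') = fQ L' + b.q * (1 - fQ L') := rfl
    have hQc0 : 0 < fQ (b :: L') := by rw [hQc]; nlinarith
    set p : ℝ := bp b L' with hpdef
    set lam : ℝ := blam b L' with hlamdef
    set kap : ℝ := bkap b L' with hkapdef
    set u : ℝ := (1 - p) * b.mean / ((1 - p) * b.mean + p * (1 - fQ L') * bT L') with hudef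
    set v : ℝ := p * (1 - fQ L') * bT L' / ((1 - p) * b.mean + p * (1 - fQ L') * bT L') with hvdef
    have hlamE : lam = p * (b.mean - (1 - fQ L') * bT L') / b.mean := by rw [hlamdef]; rfl
    have hkapE : kap = ((1 - p + p * fQ L') * bT L' - (1 - p) * b.mean) / bT L' := by rw [hkapdef]; rfl
    have hDpos : 0 < (1 - p) * b.mean + p * (1 - fQ L') * bT L' := by
      have := hD0; unfold bD at this; rw [hpdef]; exact this
    have hu0 : 0 ≤ u := (div_pos (mul_pos (by linarith) hR) hDpos).le
    have hv0 : 0 ≤ v := (div_pos (mul_pos (mul_pos hp0 (by linarith)) hT0) hDpos).le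
    have h1p : 1 - p = (1 - b.q) * fQ L' / fQ (b :: L') := by
      rw [hpdef]; unfold bp; field_simp; rw [hQc]; ring
    -- the X-leaf versions of `b` at the gate `lam`
    obtain ⟨C, hC, θ, g, yv, tv, nv, ν, hθ0, hθ1, hνmix, hν⟩ := leaf_versions b (hL b List.mem_cons_self) lam hl0 hl1 y0 hy0 hy1
    -- law facts of the pieces `P i` and of the versions
    have Pfacts : ∀ i, (∀ k, 0 ≤ P i k) ∧ (∀ k, t i < k → P i k = 0) ∧ (∑ k ∈ Finset.range (t i + 1), P i k = 1) := by
      intro i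
      obtain ⟨hTP, _, _, _, _⟩ := hP i
      obtain ⟨_, _, P0, PM, P1, _⟩ := hTP.lawFacts
      exact ⟨P0, PM, P1⟩
    have νfacts : ∀ c, (∀ k, 0 ≤ ν c k) ∧ (∀ k, tv c < k → ν c k = 0) ∧ (∑ k ∈ Finset.range (tv c + 1), ν c k = 1) := by
      intro c
      obtain ⟨_, _, hTν, _, _, _, _⟩ := hν c
      obtain ⟨_, _, ν0, νM, ν1, _⟩ := hTν.lawFacts
      exact ⟨ν0, νM, ν1⟩
    refine ⟨(ι × C) ⊕ ι, inferInstance,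
      Sum.elim (fun ic => ω ic.1 * u * θ ic.2) (fun i => ω i * v),
      Sum.elim (fun ic => m ic.1 + (nv ic.2 + 1)) (fun i => (m i + 1) + b.n),
      Sum.elim (fun ic => t ic.1 + tv ic.2) (fun i => t i + b.M),
      Sum.elim (fun ic => min (y ic.1) (g ic.2 * yv ic.2)) (fun i => min (kap * y i) b.x₁),
      Sum.elim (fun ic => lconv (t ic.1) (tv ic.2) (P ic.1) (gate (ν ic.2) (g ic.2))) (fun i => lconv (t i) b.M (gate (P i) kap) b.ρ),
      ?_, ?_, fun h => ?_, ?_⟩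
    · -- weights ≥ 0
      rintro (⟨i, c⟩ | i)
      · exact mul_nonneg (mul_nonneg (hω0 i) hu0) (hθ0 c)
      · exact mul_nonneg (hω0 i) hv0
    · -- total weight
      rw [Fintype.sum_sum_type, Fintype.sum_prod_type]
      simp only [Sum.elim_inl, Sum.elim_inr]
      have e : ∀ i, ∑ c, ω i * u * θ c = ω i * u := fun i => by rw [← Finset.mul_sum, hθ1, mul_one]
      simp_rw [e]
      rw [← Finset.sum_add_distrib]
      have e2 : ∀ i, ω i * u + ω i * v = ω i * (u + v) := fun i => by ring
      simp_rw [e2]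
      rw [← Finset.sum_mul, hω1, one_mul, hudef, hvdef]
      exact huv
    · -- the mixture identity at `h`
      rw [Fintype.sum_sum_type, Fintype.sum_prod_type]
      simp only [Sum.elim_inl, Sum.elim_inr]
      -- collapse the versions of the X-leaf: Σ_c θ_c · lconv P (gate ν g) = lconv P (gate b.ρ lam)  (tops normalised to (ftop L', b.M))
      have eXc : ∀ i c, lconv (t i) (tv c) (P i) (gate (ν c) (g c)) h = lconv (ftop L') b.M (P i) (gate (ν c) (g c)) h := by
        intro i c
        obtain ⟨_, htt, _, _, _⟩ := hP i
        obtain ⟨_, _, _, htv, _, _, _⟩ := hν c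
        have gM : ∀ k, tv c < k → gate (ν c) (g c) k = 0 := fun k hk => by
          rw [gate_apply, (νfacts c).2.1 k hk, if_neg (by omega)]; ring
        rw [← lconv_top_right_of_le (t i) (tv c) b.M _ _ htv gM h, ← lconv_top_left_of_le (t i) (ftop L') b.M _ _ htt (Pfacts i).2.1 h]
      have eX : ∀ i, ∑ c, ω i * u * θ c * lconv (t i) (tv c) (P i) (gate (ν c) (g c)) h
          = ω i * u * (lam * lconv (ftop L') b.M (P i) b.ρ h + (1 - lam) * P i h) := by
        intro i
        have e1 : ∀ c, ω i * u * θ c * lconv (t i) (tv c) (P i) (gate (ν c) (g c)) h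
            = ω i * u * (θ c * lconv (ftop L') b.M (P i) (gate (ν c) (g c)) h) := fun c => by rw [eXc i c]; ring
        rw [Finset.sum_congr rfl fun c _ => e1 c, ← Finset.mul_sum]
        congr 1
        have e2 := lconv_fsum_right Finset.univ (ftop L') b.M θ (P i) (fun c => gate (ν c) (g c)) h
        rw [← e2]
        have e3 : (fun k => ∑ c, θ c * gate (ν c) (g c) k) = gate b.ρ lam := funext fun k => (hνmix k).symm
        rw [e3]
        have PM' : ∀ k, ftop L' < k → P i k = 0 := fun k hk => (Pfacts i).2.1 k (lt_of_le_of_lt (hP i).2.1 hk)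
        exact lconv_gate_right _ _ _ _ _ PM' h
      have eY : ∀ i, lconv (t i) b.M (gate (P i) kap) b.ρ h = kap * lconv (ftop L') b.M (P i) b.ρ h + (1 - kap) * b.ρ h := by
        intro i
        obtain ⟨_, htt, _, _, _⟩ := hP i
        have gM : ∀ k, t i < k → gate (P i) kap k = 0 := fun k hk => by
          rw [gate_apply, (Pfacts i).2.1 k hk, if_neg (by omega)]; ring
        rw [← lconv_top_left_of_le (t i) (ftop L') b.M _ _ htt gM h, lconv_gate_left _ _ _ _ _ ρM h]
      simp_rw [eX, eY]
      -- from here on: identical to the unsplit bubble step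
      set A : ℝ := ∑ i, ω i * lconv (ftop L') b.M (P i) b.ρ h with hAdef
      set B : ℝ := ∑ i, ω i * P i h with hBdef
      have emix : fbeta L' = fun k => ∑ i, ω i * P i k := funext hmix
      have hβconv : lconv (ftop L') b.M (fbeta L') b.ρ h = A := by
        rw [hAdef, emix]; exact lconv_fsum_left Finset.univ _ _ ω P b.ρ h
      have hβconv' : lconv (ftop L') b.M (fbeta L') b.ρ h = ∑ i, ω i * lconv (ftop L') b.M (P i) b.ρ h := hβconv
      have eflaw : flaw L' = fun k => fQ L' * fbeta L' k + (1 - fQ L') * (if k = 0 then (1 : ℝ) else 0) := by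
        funext k; rw [flaw_eq_gate_fbeta L' hLL hne k, gate_apply]
      have hfl : flaw (b :: L') h = b.q * lconv (ftop L') b.M (flaw L') b.ρ h + (1 - b.q) * flaw L' h := by
        show lconv (ftop L') b.M (flaw L') (gate b.ρ b.q) h = _
        exact lconv_gate_right _ _ _ _ _ fM h
      have hfl2 : lconv (ftop L') b.M (flaw L') b.ρ h = fQ L' * A + (1 - fQ L') * b.ρ h := by
        rw [eflaw, lconv_lin_left, lconv_delta_left _ _ _ ρM h, hβconv]
      have hfl3 : flaw L' h = fQ L' * B + (1 - fQ L') * (if h = 0 then (1 : ℝ) else 0) := by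
        rw [flaw_eq_gate_fbeta L' hLL hne h, gate_apply, hmix h]
      have hstep : fbeta (b :: L') h = p * fQ L' * A + p * (1 - fQ L') * b.ρ h + (1 - p) * B := by
        show (flaw (b :: L') h - (1 - fQ (b :: L')) * (if h = 0 then (1 : ℝ) else 0)) / fQ (b :: L') = _
        rw [div_eq_iff hQc0.ne', hfl, hfl2, hfl3, h1p]
        rw [show p = b.q / fQ (b :: L') from rfl]
        field_simp
        rw [hQc]
        ring
      rw [hstep]
      have eL : ∀ i, ω i * u * (lam * lconv (ftop L') b.M (P i) b.ρ h + (1 - lam) * P i h)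
            + ω i * v * (kap * lconv (ftop L') b.M (P i) b.ρ h + (1 - kap) * b.ρ h)
          = (u * lam + v * kap) * (ω i * lconv (ftop L') b.M (P i) b.ρ h) + (u * (1 - lam)) * (ω i * P i h)
            + (v * (1 - kap)) * (ω i * b.ρ h) := fun i => by ring
      rw [← Finset.sum_add_distrib]
      simp_rw [eL]
      rw [Finset.sum_add_distrib, Finset.sum_add_distrib, ← Finset.mul_sum, ← Finset.mul_sum, ← Finset.mul_sum, ← Finset.sum_mul, hω1,
        one_mul, ← hAdef, ← hBdef]
      have e1 : u * lam + v * kap = p * fQ L' := by rw [hudef, hvdef, hlamE, hkapE]; exact hmid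
      have e2 : u * (1 - lam) = 1 - p := by rw [hudef, hlamE]; exact hu1
      have e3 : v * (1 - kap) = p * (1 - fQ L') := by rw [hvdef, hkapE]; exact hv1
      rw [e1, e2, e3]
      ring
    · -- the pieces
      have htopc : ftop (b :: L') = ftop L' + b.M := rfl
      have hgc : fgates (b :: L') = fgates L' + (b.n + 1) := rfl
      have hbfl : bflS y0 (b :: L') = min (min (bflS y0 L') (xfl y0 b L')) (min b.x₁ (kap * bflS y0 L')) := by
        rw [hL'def]; rfl
      have hxflE : xfl y0 b L' = (if lam * b.mean < (b.r : ℝ) then lam * b.mean / (b.M : ℝ) * y0 else lam * b.x₁) := by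
        rw [hlamdef]; rfl
      have hmeanb : ∑ k ∈ Finset.range (b.M + 1), (k : ℝ) * b.ρ k = b.mean := rfl
      rintro (⟨i, c⟩ | i)
      · -- X-version piece `P ∗ gate_g ν`
        simp only [Sum.elim_inl]
        obtain ⟨hTP, htt, hyfl, hmg, hPmean⟩ := hP i
        obtain ⟨hy0', hy1', P0, PM, P1, _⟩ := hTP.lawFacts
        obtain ⟨hg0, hg1, hTν, htv, hnv, hνmean, hνfl⟩ := hν c
        obtain ⟨hyv0, hyv1, ν0, νM, ν1, _⟩ := hTν.lawFacts
        have hfl0 : 0 < min (y i) (g c * yv c) := lt_min hy0' (mul_pos hg0 hyv0)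
        refine ⟨?_, by rw [htopc]; omega, ?_, by rw [hgc]; omega, ?_⟩
        · exact TreeBuiltN.conv (TreeBuiltN.mono hTP hfl0 (min_le_left _ _))
            (TreeBuiltN.mono (TreeBuiltN.gate (g c) hg0 hg1 hTν) hfl0 (min_le_right _ _))
        · rw [hbfl]
          refine le_min ?_ ?_
          · exact (min_le_left _ _).trans ((min_le_left _ _).trans hyfl)
          · rw [hxflE] at *
            exact (min_le_left _ _).trans ((min_le_right _ _).trans hνfl)
        · obtain ⟨gg0, ggM, gg1⟩ := gate_laws (tv c) (ν c) (g c) hg0.le hg1.le ν0 νM ν1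
          rw [sum_mul_lconv _ _ _ _ P1 gg1, sum_mul_gate, hPmean, hνmean, hTc, hlamE]
          field_simp
          ring
      · -- Y-piece `gate_κ P ∗ ρ_b`
        simp only [Sum.elim_inr]
        obtain ⟨hTP, htt, hyfl, hmg, hPmean⟩ := hP i
        obtain ⟨hy0', hy1', P0, PM, P1, _⟩ := hTP.lawFacts
        have hfl0 : 0 < min (kap * y i) b.x₁ := lt_min (mul_pos hk0 hy0') hx₁0
        refine ⟨?_, by rw [htopc]; omega, ?_, by rw [hgc]; omega, ?_⟩
        · exact TreeBuiltN.conv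
            (TreeBuiltN.mono (TreeBuiltN.gate kap hk0 hk1 hTP) hfl0 (min_le_left _ _))
            (TreeBuiltN.mono hTb hfl0 (min_le_right _ _))
        · rw [hbfl]
          refine le_min ?_ ?_
          · exact (min_le_right _ _).trans ((min_le_right _ _).trans (mul_le_mul_of_nonneg_left hyfl hk0.le))
          · exact (min_le_right _ _).trans (min_le_left _ _)
        · obtain ⟨gg0, ggM, gg1⟩ := gate_laws (t i) (P i) kap hk0.le hk1.le P0 PM P1
          rw [sum_mul_lconv _ _ _ _ gg1 ρ1, sum_mul_gate, hPmean, hmeanb, hTc, hkapE]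
          field_simp
          ring

/-! ### The U-part and the k-general certificate, split form -/

/-- **THE CONDITIONED COMPOUND WITH THE CARRIER IS SDEC (bubble region, leaf atomization).**  Oracle below `fgates (sk :: L)`, `sk` and `L`
tree-built at floor `x`, `sk.q < fQ L`, `BubbleOK L`, `0 < y₀ < 1` ⟹ `fbeta L ∗ gate_{sk.q/fQ L} sk.ρ` is SDEC at `min (bflS y₀ L) ((sk.q / fQ L)·sk.x₁)`.
[this work] -/
theorem sdec_upart_of_bubble_split {x : ℝ} (hx0 : 0 < x) (hx1 : x < 1) (y0 : ℝ) (hy0 : 0 < y0) (hy1 : y0 < 1) (sk : Sib) (L : List Sib)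
    (hk : sk.TreeOK x) (hL : ∀ s ∈ L, s.TreeOK x) (hB : BubbleOK L)
    (hO : ∀ (x' : ℝ) (n' M' : ℕ) (μ' : ℕ → ℝ), n' < fgates (sk :: L) → TreeBuiltN x' n' M' μ' → SDEC x' M' μ')
    (hhub : sk.q < fQ L) :
    SDEC (min (bflS y0 L) (sk.q / fQ L * sk.x₁)) (ftop L + sk.M) (lconv (ftop L) sk.M (fbeta L) (gate sk.ρ (sk.q / fQ L))) := by
  have hne : L ≠ [] := by rintro rfl; exact hB
  obtain ⟨ι, hι, ω, m, t, y, P, hω0, hω1, hmix, hP⟩ := fbeta_bubble_split hx0 hx1 y0 hy0 hy1 L hL hB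
  obtain ⟨hq0, hq1, hxq, hT, _⟩ := hk
  obtain ⟨hx₁0, hx₁1, ρ0, ρM, ρ1, ρta⟩ := hT.lawFacts
  have hL' : ∀ s ∈ L, s.LawOK := fun s hs => (hL s hs).lawOK
  have hQ0 : 0 < fQ L := lt_trans hq0 hhub
  set c : ℝ := sk.q / fQ L with hcdef
  have hc0 : 0 < c := div_pos hq0 hQ0
  have hc1 : c < 1 := by rw [hcdef, div_lt_one hQ0]; exact hhub
  have hbfl0 : 0 < bflS y0 L := bflS_pos y0 hy0 L hL hB
  set wU : ℝ := min (bflS y0 L) (c * sk.x₁) with hwUdef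
  obtain ⟨gc0, gcM, gc1⟩ := gate_laws sk.M sk.ρ c hc0.le hc1.le ρ0 ρM ρ1
  intro gg hg0 hg1 j hj
  have emix : fbeta L = fun k => ∑ i, ω i * P i k := funext hmix
  have Pfacts : ∀ i, (∀ k, 0 ≤ P i k) ∧ (∀ k, t i < k → P i k = 0) ∧ (∑ k ∈ Finset.range (t i + 1), P i k = 1) := by
    intro i
    obtain ⟨hTP, _, _, _, _⟩ := hP i
    obtain ⟨_, _, P0, PM, P1, _⟩ := hTP.lawFacts
    exact ⟨P0, PM, P1⟩
  have hconv : ∀ h, lconv (ftop L) sk.M (fbeta L) (gate sk.ρ c) h = ∑ i, ω i * lconv (t i) sk.M (P i) (gate sk.ρ c) h := by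
    intro h; rw [emix, lconv_fsum_left Finset.univ _ _ ω P _ h]
    refine Finset.sum_congr rfl fun i _ => ?_
    rw [lconv_top_left_of_le (t i) (ftop L) sk.M _ _ (hP i).2.1 (Pfacts i).2.1 h]
  have hgate : ∀ h, gate (lconv (ftop L) sk.M (fbeta L) (gate sk.ρ c)) gg h
      = ∑ i, ω i * gate (lconv (t i) sk.M (P i) (gate sk.ρ c)) gg h := by
    intro h
    have e : lconv (ftop L) sk.M (fbeta L) (gate sk.ρ c) = fun k => ∑ i, ω i * lconv (t i) sk.M (P i) (gate sk.ρ c) k := funext hconv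
    rw [e]
    exact gate_sum_affine Finset.univ ω _ gg hω1 h
  have hpiece : ∀ i, 0 < ω i →
      DECAtT (gg * wU) (gg * (bT L + c * sk.mean)) j (ftop L + sk.M) (gate (lconv (t i) sk.M (P i) (gate sk.ρ c)) gg) := by
    intro i _
    obtain ⟨hTP, htt, hyfl, hmg, hPmean⟩ := hP i
    obtain ⟨hy0', hy1', P0, PM, P1, Pta⟩ := hTP.lawFacts
    have hfl0 : 0 < min (y i) (c * sk.x₁) := lt_min hy0' (mul_pos hc0 hx₁0)
    have hZ : TreeBuiltN (min (y i) (c * sk.x₁)) (m i + (sk.n + 1)) (t i + sk.M) (lconv (t i) sk.M (P i) (gate sk.ρ c)) :=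
      TreeBuiltN.conv (TreeBuiltN.mono hTP hfl0 (min_le_left _ _))
        (TreeBuiltN.mono (TreeBuiltN.gate c hc0 hc1 hT) hfl0 (min_le_right _ _))
    obtain ⟨hz0, hz1, Z0, ZM, Z1, Zta⟩ := hZ.lawFacts
    have hSZ : SDEC (min (y i) (c * sk.x₁)) (t i + sk.M) (lconv (t i) sk.M (P i) (gate sk.ρ c)) :=
      hO _ _ _ _ (by simp only [fgates]; omega) hZ
    have hle : gg * wU ≤ gg * min (y i) (c * sk.x₁) :=
      mul_le_mul_of_nonneg_left (le_min ((min_le_left _ _).trans hyfl) (min_le_right _ _)) hg0.le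
    have hlt1 : gg * min (y i) (c * sk.x₁) < 1 := by nlinarith
    have d : DECAt (gg * min (y i) (c * sk.x₁)) j (t i + sk.M) (gate (lconv (t i) sk.M (P i) (gate sk.ρ c)) gg) := by
      by_cases hjt : j < t i + sk.M
      · exact hSZ gg hg0 hg1 j hjt
      · exact decAt_gate_of_top_le (t i + sk.M) _ (min (y i) (c * sk.x₁)) gg hz0.le hlt1 hg0.le hg1 Z0 ZM Z1 Zta j (not_lt.1 hjt)
    have d' := decAt_mono_floor hle hlt1 d
    rw [decAt_iff_decAtT, sum_mul_gate, sum_mul_lconv _ _ _ _ P1 gc1, hPmean, sum_mul_gate] at d'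
    exact decAtT_mono_top d' (by omega)
  have hmixdec := decAtT_mixture_finset Finset.univ ω (fun i => gate (lconv (t i) sk.M (P i) (gate sk.ρ c)) gg)
    (fun i _ => hω0 i) hω1 (fun i _ hwi => hpiece i hwi)
  obtain ⟨β0, βM, β1, βmean⟩ := fbeta_laws L hL' hne
  have hmean : ∑ h ∈ Finset.range (ftop L + sk.M + 1), (h : ℝ) * gate (lconv (ftop L) sk.M (fbeta L) (gate sk.ρ c)) gg h
      = gg * (bT L + c * sk.mean) := by
    rw [sum_mul_gate, sum_mul_lconv _ _ _ _ β1 gc1, βmean, sum_mul_gate]; rfl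
  rw [decAt_iff_decAtT, hmean]
  exact decAtT_congr (fun h => (hgate h).symm) hmixdec

/-- **IDENTITY I_k⁺ (k-GENERAL, BUBBLE REGION WITH LEAF ATOMIZATION): the sibling step for `carrier :: compound`.**  For a floor `0 < x < 1`, a
tree-built carrier `sk` and compound `L` at floor `x`, GIVEN the oracle below `fgates (sk :: L)`: if `sk.q < fQ L`, `BubbleOK L` and, for some blob-floor
parameter `0 < y₀ < 1`, `x ≤ fQ L · bflS y₀ L`, then `flaw (sk :: L)` is SDEC at `x`. [this work] -/
theorem sdec_flaw_cons_of_bubble_split {x : ℝ} (hx0 : 0 < x) (hx1 : x < 1) (y0 : ℝ) (hy0 : 0 < y0) (hy1 : y0 < 1) (sk : Sib) (L : List Sib)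
    (hk : sk.TreeOK x) (hL : ∀ s ∈ L, s.TreeOK x) (hB : BubbleOK L)
    (hO : ∀ (x' : ℝ) (n' M' : ℕ) (μ' : ℕ → ℝ), n' < fgates (sk :: L) → TreeBuiltN x' n' M' μ' → SDEC x' M' μ')
    (hhub : sk.q < fQ L) (hxU : x ≤ fQ L * bflS y0 L) :
    SDEC x (ftop (sk :: L)) (flaw (sk :: L)) := by
  have hne : L ≠ [] := by rintro rfl; exact hB
  have hU := sdec_upart_of_bubble_split hx0 hx1 y0 hy0 hy1 sk L hk hL hB hO hhub
  obtain ⟨hq0, hq1, hxq, hT, hnp⟩ := hk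
  obtain ⟨hx₁0, hx₁1, _, _, _, _⟩ := hT.lawFacts
  have hQ0 : 0 < fQ L := lt_trans hq0 hhub
  have hbfl0 : 0 < bflS y0 L := bflS_pos y0 hy0 L hL hB
  have hc0 : 0 < sk.q / fQ L := div_pos hq0 hQ0
  have hc1 : sk.q / fQ L < 1 := by rw [div_lt_one hQ0]; exact hhub
  have hw0 : 0 ≤ min (bflS y0 L) (sk.q / fQ L * sk.x₁) := (lt_min hbfl0 (mul_pos hc0 hx₁0)).le
  have hw1 : min (bflS y0 L) (sk.q / fQ L * sk.x₁) < 1 := by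
    have : sk.q / fQ L * sk.x₁ < 1 := by nlinarith
    exact lt_of_le_of_lt (min_le_right _ _) this
  refine sdec_flaw_cons_of_upart hx0 hx1 sk L ⟨hq0, hq1, hxq, hT, hnp⟩ hL hne hO hhub.le _ hw0 hw1 hU ?_
  rcases le_total (bflS y0 L) (sk.q / fQ L * sk.x₁) with hle | hle
  · rw [min_eq_left hle]; exact hxU
  · rw [min_eq_right hle]
    have : fQ L * (sk.q / fQ L * sk.x₁) = sk.q * sk.x₁ := by field_simp
    rw [this]; exact hxq

end LawDec
end Quant
end Summit.CriticalPhenomena.PercolationContinuityZ3.Theorems
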